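import Literature.Probability.RandomPlanarGeometry.ParaObservableProcess
import HarnessLib

/-!
# Driving local martingales from the spin-1/3 observable, without moment bounds (`κ = 6`)

Topic `Literature/Probability/RandomPlanarGeometry`; theorems only, no definition, no named
fact. The percolation (`κ = 6`) companion of `ObservableLocalMartingale.lean` (FK-Ising,
`κ = 16/3`) and `SpinObservableLocalMartingale.lean` (spin-Ising, `κ = 3`), which see for the
method: localisation at the far-field stopping time `ρ_L = farStopTime W L` of a FIXED level `L`
and observable levels `y → ∞`, so that the coefficient martingales of the far-field expansion
are exact on the stopped processes and no integrability of the driving process is needed.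

For the spin-1/3 observable `(z g_t'/(g_t - W_t))^{1/3} = 1 + W_t/(3z) + (2W_t² - 12t)/(9z²)
+ O(z⁻³)` (Duminil-Copin 2012, p. 9; `ParaObservableFarField.lean`) the two coefficients give
the driving martingales `W_t` and `W_t² - 6t` (the time-limited observable process is written
with its explicit expression, as in `ParaObservableProcess.lean`):

* `martingale_stoppedDriver_of_paraObservable`, `martingale_stoppedQuad_of_paraObservable` —
  `W^{ρ_L}` and `(W^{ρ_L})² - 6 (· ∧ ρ_L)` are martingales (general coefficient lemmas of
  `SpinObservableDrivingMartingales.lean` with `a = 1/3`, `b = 2/9`, `κ = 6`);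
* `isLocalMartingale_hasQuadraticVariation_of_paraObservable` — Lévy's format for
  `X = (√6)⁻¹ W`: a continuous local martingale with `⟨X⟩_t = t`;
* `isLocalMartingale_hasQuadraticVariation_of_paraCylinderIdentity` — the same from the
  cylinder identity of the time-limited observable process in the natural filtration of `W`
  (`martingale_re_im_paraObservableProcess_of_cylinder`).

## References

* H. Duminil-Copin, *Divergence of the correlation length for critical planar FK percolation
  with `1 ≤ q ≤ 4` via parafermionic observables*, J. Phys. A 45 (2012) 494013
  (arXiv:1208.3787), p. 9.
* D. Chelkak, H. Duminil-Copin, C. Hongler, A. Kemppainen, S. Smirnov, *Convergence of Ising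
  interfaces to Schramm's SLE curves*, C. R. Math. Acad. Sci. Paris 352 (2014), §3.
* D. Revuz, M. Yor, *Continuous Martingales and Brownian Motion* (1999), Ch. IV, Def. (1.5),
  Thm. (3.6).
-/

noncomputable section

open Set Filter Topology Metric MeasureTheory Complex
open scoped NNReal

namespace Literature.Probability.RandomPlanarGeometry

namespace Loewner

open Literature.Probability.Process

variable {Ω : Type*} {m : MeasurableSpace Ω} {W : ℝ≥0 → Ω → ℝ}

/-! ### The two stopped martingales at a fixed level -/

section Stopped

variable {𝓕 : Filtration ℝ≥0 m} {P : Measure Ω} [IsProbabilityMeasure P]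

/-- **Order one, localised: the driver stopped at `ρ_L` is a martingale**, if the imaginary
parts of the time-limited spin-1/3 observables `N^y` are `𝓕`-martingales for all `y ≥ y₀`
(`W` strongly adapted, continuous paths, `W_0 = 0`; no moment hypothesis): the general
coefficient lemma with `a = 1/3`, the rescaled martingale `(y/L) Im N^y_{·∧ρ_L}` and
`K = 64 L²/y²` gives an `L¹` defect `≤ 384 (L/128 + √t)³/y² → 0`.
[cite: DuminilCopin2012Parafermion, p. 9] -/
theorem martingale_stoppedDriver_of_paraObservable (hWad : StronglyAdapted 𝓕 W)
    (hWc : ∀ ω, Continuous (W · ω)) (hW0 : ∀ ω, W 0 ω = 0) {L : ℝ} (hL : 0 < L) {y₀ : ℝ}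
    (him : ∀ y, y₀ ≤ y → Martingale (fun r ω ↦ ((((I * y) * deriv (map (fun u ↦ W u ω) (min r (cdhksTime y))) (I * y) /
          (map (fun u ↦ W u ω) (min r (cdhksTime y)) (I * y) - ((W (min r (cdhksTime y)) ω : ℝ) : ℂ))) ^ ((3 : ℂ)⁻¹))).im) 𝓕 P) :
    Martingale (stoppedProcess W (farStopTime W L)) 𝓕 P := by
  set ρ := farStopTime W L with hρ
  set V := stoppedProcess W ρ with hV
  have hVad : StronglyAdapted 𝓕 V := stronglyAdapted_stoppedProcess_farStopTime hWad hWc L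
  have hVc : ∀ ω, Continuous (V · ω) := continuous_stoppedProcess_farStopTime hWc L
  have hVbd : ∀ r ω, |V r ω| ≤ L / 128 := abs_stoppedProcess_farStopTime_le hWc hW0 hL
  have hVint : ∀ r, Integrable (V r) P :=
    integrable_stoppedProcess_farStopTime hWad hWc hW0 hL
  have hVV : stoppedProcess V (farStopTime V L) = V :=
    funext fun r ↦ funext fun ω ↦ stoppedProcess_stoppedProcess_farStopTime hWc L r ω
  set X : ℝ≥0 → ℝ := fun t ↦ (L / 128 + Real.sqrt t) ^ 3 with hX
  have key : ∀ s t : ℝ≥0, s ≤ t → ∀ y, max y₀ L ≤ y →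
      ∫ ω, |(P[V t | 𝓕 s]) ω - V s ω| ∂P ≤ 384 * X t / y ^ 2 := by
    intro s t hst y hy
    have hLy : L ≤ y := (le_max_right _ _).trans hy
    have hy0y : y₀ ≤ y := (le_max_left _ _).trans hy
    have hy : 0 < y := hL.trans_le hLy
    have hN : Martingale (stoppedProcess (fun r ω ↦ ((((I * y) * deriv (map (fun u ↦ W u ω) (min r (cdhksTime y))) (I * y) /
          (map (fun u ↦ W u ω) (min r (cdhksTime y)) (I * y) - ((W (min r (cdhksTime y)) ω : ℝ) : ℂ))) ^ ((3 : ℂ)⁻¹))).im) ρ) 𝓕 P :=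
      martingale_stoppedProcess_farStopTime hWad hWc L (him y hy0y)
        fun ω ↦ continuous_im.comp (continuous_paraObservableProcess hWc hy ω)
    set Oim : ℝ≥0 → Ω → ℝ :=
      (y / L) • stoppedProcess (fun r ω ↦ ((((I * y) * deriv (map (fun u ↦ W u ω) (min r (cdhksTime y))) (I * y) /
            (map (fun u ↦ W u ω) (min r (cdhksTime y)) (I * y) - ((W (min r (cdhksTime y)) ω : ℝ) : ℂ))) ^ ((3 : ℂ)⁻¹))).im) ρ with hOim
    have hOm : Martingale Oim 𝓕 P := hN.smul _
    have hM : MemLp (fun _ : Ω ↦ L / 128) 3 P := memLp_const _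
    have hbd : ∀ᵐ ω ∂P, ∀ u, u ≤ t → |V u ω| ≤ L / 128 := ae_of_all _ fun ω u _ ↦ hVbd u ω
    have hcoef : ∀ᵐ ω ∂P, ∀ r, r ≤ t →
        |Oim r ω + 1 / 3 * stoppedProcess V (farStopTime V L) r ω / L| ≤
          64 * L ^ 2 / y ^ 2 * ((L / 128 + Real.sqrt t) / L) ^ 3 := by
      refine ae_of_all _ fun ω r hr ↦ ?_
      have h1 := abs_im_stoppedProcess_paraObservableProcess_add_le hWc hW0 hL hLy hr ω
      rw [stoppedProcess_stoppedProcess_farStopTime hWc L r ω]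
      have heq : Oim r ω + 1 / 3 * stoppedProcess W (farStopTime W L) r ω / L =
          (y / L) * ((stoppedProcess (fun t ω ↦ (((I * y) * deriv (map (fun u ↦ W u ω) (min t (cdhksTime y))) (I * y) /
                (map (fun u ↦ W u ω) (min t (cdhksTime y)) (I * y) - ((W (min t (cdhksTime y)) ω : ℝ) : ℂ))) ^ ((3 : ℂ)⁻¹))) (farStopTime W L) r ω).im +
            stoppedProcess W (farStopTime W L) r ω / (3 * y)) := by
        simp only [hOim, Pi.smul_apply, smul_eq_mul, stoppedProcess, hρ]
        field_simp
      rw [heq, abs_mul, abs_of_pos (div_pos hy hL)]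
      calc y / L * |(stoppedProcess (fun t ω ↦ (((I * y) * deriv (map (fun u ↦ W u ω) (min t (cdhksTime y))) (I * y) /
            (map (fun u ↦ W u ω) (min t (cdhksTime y)) (I * y) - ((W (min t (cdhksTime y)) ω : ℝ) : ℂ))) ^ ((3 : ℂ)⁻¹))) (farStopTime W L) r ω).im +
              stoppedProcess W (farStopTime W L) r ω / (3 * y)|
          ≤ y / L * (64 * ((L / 128 + Real.sqrt t) / y) ^ 3) := by gcongr
        _ = 64 * L ^ 2 / y ^ 2 * ((L / 128 + Real.sqrt t) / L) ^ 3 := by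
          field_simp
    have h := integral_abs_condExp_stoppedDriver_sub_le_of_coeff hVad hVc hL
      (by norm_num : (1 / 3 : ℝ) ≠ 0) hOm hst hM (fun _ ↦ by positivity) hbd hcoef
    rw [hVV] at h
    refine h.trans (le_of_eq ?_)
    rw [integral_const, smul_eq_mul, abs_of_pos (by norm_num : (0 : ℝ) < 1 / 3)]
    simp only [probReal_univ, one_mul, hX]
    field_simp
    norm_num
  refine ⟨hVad, fun s t hst ↦ ?_⟩
  refine condExp_ae_eq_of_approx (hVint t) (hVint s) fun ε hε ↦
    ⟨V t, V s, hVint t, hVint s, by simp [hε.le], by simp [hε.le], ?_⟩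
  have hc := tendsto_const_div_pow_atTop_nhds_zero (384 * X t) two_ne_zero
  obtain ⟨y, hy1, hy2⟩ := ((eventually_ge_atTop (max y₀ L)).and
    (hc.eventually (Iic_mem_nhds hε))).exists
  exact (key s t hst y hy1).trans hy2

/-- **Order two, localised: `(W^{ρ_L})² - 6 (· ∧ ρ_L)` is a martingale**, if the real parts of
`N^y` are martingales for all `y ≥ y₀`: the general coefficient lemma with `b = 2/9`, `κ = 6`,
the rescaled martingale `1 + (y/L)² (Re N^y_{·∧ρ_L} - 1)` and `K = 64 L/y` gives an `L¹`
defect `≤ 576 (L/128 + √t)³/y → 0`. No moment hypothesis.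
[cite: DuminilCopin2012Parafermion, p. 9] -/
theorem martingale_stoppedQuad_of_paraObservable (hWad : StronglyAdapted 𝓕 W)
    (hWc : ∀ ω, Continuous (W · ω)) (hW0 : ∀ ω, W 0 ω = 0) {L : ℝ} (hL : 0 < L) {y₀ : ℝ}
    (hre : ∀ y, y₀ ≤ y → Martingale (fun r ω ↦ ((((I * y) * deriv (map (fun u ↦ W u ω) (min r (cdhksTime y))) (I * y) /
          (map (fun u ↦ W u ω) (min r (cdhksTime y)) (I * y) - ((W (min r (cdhksTime y)) ω : ℝ) : ℂ))) ^ ((3 : ℂ)⁻¹))).re) 𝓕 P) :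
    Martingale (fun r ω ↦ stoppedProcess W (farStopTime W L) r ω ^ 2 -
      6 * (((min (r : WithTop ℝ≥0) (farStopTime W L ω)).untopA : ℝ≥0) : ℝ)) 𝓕 P := by
  set ρ := farStopTime W L with hρ
  set V := stoppedProcess W ρ with hV
  have hVad : StronglyAdapted 𝓕 V := stronglyAdapted_stoppedProcess_farStopTime hWad hWc L
  have hVc : ∀ ω, Continuous (V · ω) := continuous_stoppedProcess_farStopTime hWc L
  have hVbd : ∀ r ω, |V r ω| ≤ L / 128 := abs_stoppedProcess_farStopTime_le hWc hW0 hL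
  have hVV : stoppedProcess V (farStopTime V L) = V :=
    funext fun r ↦ funext fun ω ↦ stoppedProcess_stoppedProcess_farStopTime hWc L r ω
  have hρρ : farStopTime V L = ρ := funext fun ω ↦ farStopTime_stoppedProcess_self hWc L ω
  set Q : ℝ≥0 → Ω → ℝ := fun r ω ↦ V r ω ^ 2 -
    6 * (((min (r : WithTop ℝ≥0) (ρ ω)).untopA : ℝ≥0) : ℝ) with hQ
  have hQad : StronglyAdapted 𝓕 Q := fun r ↦
    ((hVad r).pow 2).sub ((stronglyAdapted_stoppedClock_farStopTime hWad hWc L r).const_mul _)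
  have hM : MemLp (fun _ : Ω ↦ L / 128) 3 P := memLp_const _
  have hM2 : Integrable (fun _ : Ω ↦ (L / 128) ^ 2) P := integrable_const _
  have hQint : ∀ r, Integrable (Q r) P := by
    intro r
    have hbd : ∀ᵐ ω ∂P, ∀ u, u ≤ r → |V u ω| ≤ L / 128 := ae_of_all _ fun ω u _ ↦ hVbd u ω
    have := integrable_stoppedQuad' hVad hVc hM2 hbd le_rfl L 6
    rwa [hVV, hρρ] at this
  set X : ℝ≥0 → ℝ := fun t ↦ (L / 128 + Real.sqrt t) ^ 3 with hX
  have key : ∀ s t : ℝ≥0, s ≤ t → ∀ y, max y₀ L ≤ y →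
      ∫ ω, |(P[Q t | 𝓕 s]) ω - Q s ω| ∂P ≤ 576 * X t / y := by
    intro s t hst y hy
    have hLy : L ≤ y := (le_max_right _ _).trans hy
    have hy0y : y₀ ≤ y := (le_max_left _ _).trans hy
    have hy : 0 < y := hL.trans_le hLy
    have hN : Martingale (stoppedProcess (fun r ω ↦ ((((I * y) * deriv (map (fun u ↦ W u ω) (min r (cdhksTime y))) (I * y) /
          (map (fun u ↦ W u ω) (min r (cdhksTime y)) (I * y) - ((W (min r (cdhksTime y)) ω : ℝ) : ℂ))) ^ ((3 : ℂ)⁻¹))).re) ρ) 𝓕 P :=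
      martingale_stoppedProcess_farStopTime hWad hWc L (hre y hy0y)
        fun ω ↦ continuous_re.comp (continuous_paraObservableProcess hWc hy ω)
    set Ore : ℝ≥0 → Ω → ℝ := (fun _ _ ↦ (1 : ℝ)) +
      (y ^ 2 / L ^ 2) • (stoppedProcess (fun r ω ↦ ((((I * y) * deriv (map (fun u ↦ W u ω) (min r (cdhksTime y))) (I * y) /
            (map (fun u ↦ W u ω) (min r (cdhksTime y)) (I * y) - ((W (min r (cdhksTime y)) ω : ℝ) : ℂ))) ^ ((3 : ℂ)⁻¹))).re) ρ -
        fun _ _ ↦ (1 : ℝ)) with hOre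
    have hOm : Martingale Ore 𝓕 P :=
      (martingale_const 𝓕 P (1 : ℝ)).add ((hN.sub (martingale_const 𝓕 P (1 : ℝ))).smul _)
    have hbd : ∀ᵐ ω ∂P, ∀ u, u ≤ t → |V u ω| ≤ L / 128 := ae_of_all _ fun ω u _ ↦ hVbd u ω
    have hcoef : ∀ᵐ ω ∂P, ∀ r, r ≤ t →
        |Ore r ω - 1 + 2 / 9 * (stoppedProcess V (farStopTime V L) r ω ^ 2 -
          6 * (((min (r : WithTop ℝ≥0) (farStopTime V L ω)).untopA : ℝ≥0) : ℝ)) / L ^ 2| ≤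
          64 * L / y * ((L / 128 + Real.sqrt t) / L) ^ 3 := by
      refine ae_of_all _ fun ω r hr ↦ ?_
      have h1 := abs_re_stoppedProcess_paraObservableProcess_sub_le hWc hW0 hL hLy hr ω
      rw [stoppedProcess_stoppedProcess_farStopTime hWc L r ω, farStopTime_stoppedProcess_self hWc L ω]
      have heq : Ore r ω - 1 + 2 / 9 * (stoppedProcess W (farStopTime W L) r ω ^ 2 -
            6 * (((min (r : WithTop ℝ≥0) (farStopTime W L ω)).untopA : ℝ≥0) : ℝ)) / L ^ 2 =
          (y ^ 2 / L ^ 2) * ((stoppedProcess (fun t ω ↦ (((I * y) * deriv (map (fun u ↦ W u ω) (min t (cdhksTime y))) (I * y) /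
                (map (fun u ↦ W u ω) (min t (cdhksTime y)) (I * y) - ((W (min t (cdhksTime y)) ω : ℝ) : ℂ))) ^ ((3 : ℂ)⁻¹))) (farStopTime W L) r ω).re -
            1 + (2 * stoppedProcess W (farStopTime W L) r ω ^ 2 -
              12 * (((min (r : WithTop ℝ≥0) (farStopTime W L ω)).untopA : ℝ≥0) : ℝ)) /
              (9 * y ^ 2)) := by
        simp only [hOre, Pi.add_apply, Pi.smul_apply, Pi.sub_apply, smul_eq_mul, stoppedProcess, hρ]
        field_simp
        ring
      rw [heq, abs_mul, abs_of_pos (by positivity : (0 : ℝ) < y ^ 2 / L ^ 2)]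
      calc y ^ 2 / L ^ 2 * |(stoppedProcess (fun t ω ↦ (((I * y) * deriv (map (fun u ↦ W u ω) (min t (cdhksTime y))) (I * y) /
            (map (fun u ↦ W u ω) (min t (cdhksTime y)) (I * y) - ((W (min t (cdhksTime y)) ω : ℝ) : ℂ))) ^ ((3 : ℂ)⁻¹))) (farStopTime W L) r ω).re -
              1 + (2 * stoppedProcess W (farStopTime W L) r ω ^ 2 -
                12 * (((min (r : WithTop ℝ≥0) (farStopTime W L ω)).untopA : ℝ≥0) : ℝ)) /
                (9 * y ^ 2)|
          ≤ y ^ 2 / L ^ 2 * (64 * ((L / 128 + Real.sqrt t) / y) ^ 3) := by gcongr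
        _ = 64 * L / y * ((L / 128 + Real.sqrt t) / L) ^ 3 := by
          field_simp
    have h := integral_abs_condExp_stoppedQuad_sub_le_of_coeff hVad hVc (κ := 6) hL
      (by norm_num : (2 / 9 : ℝ) ≠ 0) hOm hst hM (fun _ ↦ by positivity) hbd hcoef
    rw [hVV, hρρ] at h
    refine h.trans (le_of_eq ?_)
    rw [integral_const, smul_eq_mul, abs_of_pos (by norm_num : (0 : ℝ) < 2 / 9)]
    simp only [probReal_univ, one_mul, hX]
    field_simp
    norm_num
  refine ⟨hQad, fun s t hst ↦ ?_⟩
  refine condExp_ae_eq_of_approx (hQint t) (hQint s) fun ε hε ↦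
    ⟨Q t, Q s, hQint t, hQint s, by simp [hε.le], by simp [hε.le], ?_⟩
  have hc := tendsto_const_div_pow_atTop_nhds_zero (576 * X t) one_ne_zero
  simp only [pow_one] at hc
  obtain ⟨y, hy1, hy2⟩ := ((eventually_ge_atTop (max y₀ L)).and
    (hc.eventually (Iic_mem_nhds hε))).exists
  exact (key s t hst y hy1).trans hy2

end Stopped

/-! ### Local martingales and Lévy's format (`κ = 6`) -/

section Local

variable {𝓕 : Filtration ℝ≥0 m} {P : Measure Ω} [IsProbabilityMeasure P]

/-- **Lévy's format (spin 1/3): `X = (√6)⁻¹ W` is a continuous local martingale with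
`⟨X⟩_t = t`**, from the martingale property of the real and imaginary parts of the
time-limited spin-1/3 observables at all large levels `y ≥ y₀` (`W` strongly adapted,
continuous paths, `W_0 = 0`); no moment hypothesis. Localisation at the far-field stopping
times `ρ_{n+1}` (`martingale_stoppedDriver_of_paraObservable`,
`martingale_stoppedQuad_of_paraObservable`). [cite: DuminilCopin2012Parafermion, p. 9] -/
theorem isLocalMartingale_hasQuadraticVariation_of_paraObservable (hWad : StronglyAdapted 𝓕 W)
    (hWc : ∀ ω, Continuous (W · ω)) (hW0 : ∀ ω, W 0 ω = 0) {y₀ : ℝ}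
    (hre : ∀ y, y₀ ≤ y → Martingale (fun r ω ↦ ((((I * y) * deriv (map (fun u ↦ W u ω) (min r (cdhksTime y))) (I * y) /
          (map (fun u ↦ W u ω) (min r (cdhksTime y)) (I * y) - ((W (min r (cdhksTime y)) ω : ℝ) : ℂ))) ^ ((3 : ℂ)⁻¹))).re) 𝓕 P)
    (him : ∀ y, y₀ ≤ y → Martingale (fun r ω ↦ ((((I * y) * deriv (map (fun u ↦ W u ω) (min r (cdhksTime y))) (I * y) /
          (map (fun u ↦ W u ω) (min r (cdhksTime y)) (I * y) - ((W (min r (cdhksTime y)) ω : ℝ) : ℂ))) ^ ((3 : ℂ)⁻¹))).im) 𝓕 P) :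
    IsLocalMartingale (fun t ω ↦ (Real.sqrt 6)⁻¹ * W t ω) 𝓕 P ∧
      HasQuadraticVariation (fun t ω ↦ (Real.sqrt 6)⁻¹ * W t ω) (fun t _ ↦ (t : ℝ)) 𝓕 P := by
  have hloc := isLocalizingSequence_farStopTime hWad hWc (P := P)
  have hLn : ∀ n : ℕ, (0 : ℝ) < n + 1 := fun n ↦ by positivity
  have hsq : (Real.sqrt 6)⁻¹ ^ 2 = (6⁻¹ : ℝ) := by
    rw [inv_pow, Real.sq_sqrt (by norm_num : (0 : ℝ) ≤ 6)]
  have h1 : IsLocalMartingale (fun t ω ↦ (Real.sqrt 6)⁻¹ * W t ω) 𝓕 P := by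
    unfold IsLocalMartingale
    refine ⟨_, hloc, fun n ↦ ?_⟩
    rw [indicator_bot_lt_farStopTime hWc hW0 (hLn n)]
    have h := (martingale_stoppedDriver_of_paraObservable hWad hWc hW0 (hLn n) him).smul
      (Real.sqrt 6)⁻¹
    have heq : stoppedProcess (fun t ω ↦ (Real.sqrt 6)⁻¹ * W t ω)
          (farStopTime W ((n : ℝ) + 1)) =
        (Real.sqrt 6)⁻¹ • stoppedProcess W (farStopTime W ((n : ℝ) + 1)) := by
      funext r ω
      simp only [stoppedProcess, Pi.smul_apply, smul_eq_mul]
    rw [heq]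
    exact h
  have h2 : IsLocalMartingale (fun t ω ↦ ((Real.sqrt 6)⁻¹ * W t ω) ^ 2 - (t : ℝ)) 𝓕 P := by
    unfold IsLocalMartingale
    refine ⟨_, hloc, fun n ↦ ?_⟩
    rw [indicator_bot_lt_farStopTime hWc hW0 (hLn n)]
    have h := (martingale_stoppedQuad_of_paraObservable hWad hWc hW0 (hLn n) hre).smul (6⁻¹ : ℝ)
    have heq : stoppedProcess (fun t ω ↦ ((Real.sqrt 6)⁻¹ * W t ω) ^ 2 - (t : ℝ))
          (farStopTime W ((n : ℝ) + 1)) =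
        (6⁻¹ : ℝ) • fun r ω ↦ stoppedProcess W (farStopTime W ((n : ℝ) + 1)) r ω ^ 2 -
          6 * (((min (r : WithTop ℝ≥0) (farStopTime W ((n : ℝ) + 1) ω)).untopA : ℝ≥0) : ℝ) := by
      funext r ω
      simp only [stoppedProcess, Pi.smul_apply, smul_eq_mul]
      rw [mul_pow, hsq]
      ring
    rw [heq]
    exact h
  exact ⟨h1,
    { adapted := fun _ ↦ measurable_const
      continuous := ae_of_all _ fun _ ↦ NNReal.continuous_coe
      monotone := ae_of_all _ fun _ _ _ h ↦ NNReal.coe_le_coe.2 h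
      zero := fun _ ↦ NNReal.coe_zero
      isLocalMartingale := h2 }⟩

/-- **From the cylinder identity of the spin-1/3 observable to Lévy's format, moment-free.**
Let `W` be a real process indexed by `[0, ∞)` with strongly measurable coordinates, continuous
paths and `W_0 = 0`, and suppose that for every `y > 0` the time-limited spin-1/3 observable
process `N^y` satisfies the cylinder identity `E[(N^y_t - N^y_s) ψ(W_{S_0}, …, W_{S_{n-1}})] = 0`
for all `s ≤ t`, all finite families of times `S_k ≤ s` and all continuous `ψ` with `|ψ| ≤ 1`
(the monotone-class form of "the observable is a martingale in the filtration generated by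
`W`"). Then `W/√6` is a continuous local martingale with quadratic variation `t` in the natural
filtration of `W` — the input of Lévy's characterisation with `κ = 6`.
[cite: DuminilCopin2012Parafermion, p. 9] -/
theorem isLocalMartingale_hasQuadraticVariation_of_paraCylinderIdentity
    (hW : ∀ t, StronglyMeasurable (W t)) (hWc : ∀ ω, Continuous (W · ω)) (hW0 : ∀ ω, W 0 ω = 0)
    (hcyl : ∀ y : ℝ, 0 < y → ∀ s t : ℝ≥0, s ≤ t → ∀ (n : ℕ) (S : Fin n → ℝ≥0), (∀ k, S k ≤ s) →
      ∀ ψ : (Fin n → ℝ) → ℝ, Continuous ψ → (∀ v, |ψ v| ≤ 1) →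
        ∫ ω, ((((I * y) * deriv (map (fun u ↦ W u ω) (min t (cdhksTime y))) (I * y) /
              (map (fun u ↦ W u ω) (min t (cdhksTime y)) (I * y) - ((W (min t (cdhksTime y)) ω : ℝ) : ℂ))) ^ ((3 : ℂ)⁻¹)) - (((I * y) * deriv (map (fun u ↦ W u ω) (min s (cdhksTime y))) (I * y) /
                    (map (fun u ↦ W u ω) (min s (cdhksTime y)) (I * y) - ((W (min s (cdhksTime y)) ω : ℝ) : ℂ))) ^ ((3 : ℂ)⁻¹))) * (ψ (fun k ↦ W (S k) ω) : ℂ) ∂P = 0) :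
    IsLocalMartingale (fun t ω ↦ (Real.sqrt 6)⁻¹ * W t ω) (Filtration.natural W hW) P ∧
      HasQuadraticVariation (fun t ω ↦ (Real.sqrt 6)⁻¹ * W t ω) (fun t _ ↦ (t : ℝ))
        (Filtration.natural W hW) P := by
  have hWad : StronglyAdapted (Filtration.natural W hW) W := Filtration.stronglyAdapted_natural hW
  refine isLocalMartingale_hasQuadraticVariation_of_paraObservable hWad hWc hW0 (y₀ := 1)
    (fun y hy ↦ ?_) (fun y hy ↦ ?_)
  · have hy0 : 0 < y := by linarith
    exact (martingale_re_im_paraObservableProcess_of_cylinder hW hWc hy0 (hcyl y hy0)).1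
  · have hy0 : 0 < y := by linarith
    exact (martingale_re_im_paraObservableProcess_of_cylinder hW hWc hy0 (hcyl y hy0)).2

end Local

end Loewner

end Literature.Probability.RandomPlanarGeometry
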